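import Summits.NavierStokesRegularity.NavierStokesRegularity.Theorems.QuantisedSymmetryPolyhedralDssProfileExistsStubSliceNonzero
import Literature.Analysis.FluidPDE.CurlFreeLiouville
import Literature.Analysis.FluidPDE.TypeIAncientMild
import HarnessLib

/-!
# Every negative slice of a witness carries vorticity — crux stmt-NavierStokesRegularity-1404
  (`QuantisedSymmetry.PolyhedralDssProfileExists`), line polyhedral_cell, stub
  stub_vorticityEverySlice (N9)

Registered stub `stub_vorticityEverySlice` (`--supports stmt-NavierStokesRegularity-1404`). Let `V`
be a Type-I ancient mild field in the Oseen gauge (`IsTypeIAncientMild C V`), exactly `c`-DSS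
(`c > 1`), with a Type-I space–time bound `HasTypeIDecay C₀ V`, and nonzero at one point of the
past. Then NO negative slice of `V` is irrotational: for every `t < 0` there is a point `x` with
`curl V(t, ·)(x) ≠ 0`.

Proof. Suppose `curl V(t₁, ·) ≡ 0` for some `t₁ < 0`. The slice `W := V(t₁)` is `C^∞`, divergence
free, curl free and bounded by `C/√(-t₁)`, hence constant by Liouville's theorem for the system
`curl W = 0`, `div W = 0` (KNSS 2009, Lemma 3.1; tree `eq_of_curl_eq_zero_of_isDivFree_of_bounded`).
The constant vanishes: `‖W(x)‖ ≤ C₀/(‖x‖ + √(-t₁)) → 0` along `x = R e₀`, `R → ∞`. So `V(t₁) = 0`,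
and the landed helpers of stub N4 propagate the vanishing to the whole past — forward on `(t₁, 0)`
by uniqueness of bounded Oseen-mild solutions (`sliceNonzero_forward`), backward along the zoom
(`sliceNonzero_backward`) — contradicting `V(t₀, x₀) ≠ 0`.
-/

noncomputable section

-- the summit namespace `…NavierStokesRegularity.NavierStokesRegularity…` is the tree convention (D-0017)
set_option linter.dupNamespace false

namespace Summit.NavierStokesRegularity.NavierStokesRegularity.Theorems.PolyhedralDssProfileExists.PolyhedralCell

open MeasureTheory Set Function Filter Topology
open Literature.Analysis Literature.Analysis.FluidPDE

/-! ### An irrotational slice of a Type-I field vanishes -/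

/-- **An irrotational negative slice is constant.** If `V` is a Type-I ancient mild field in the
Oseen gauge and `curl V(t₁, ·) ≡ 0` for some `t₁ < 0`, then the slice `V(t₁)` is constant: it is
`C²`, divergence free, curl free and bounded by `C/√(-t₁)`, and bounded solutions of the system
`curl W = 0`, `div W = 0` on `ℝ³` are constant (Liouville). [cite: KochNadirashviliSereginSverak2009, Lemma 3.1] -/
theorem vortSlice_const_of_curl_eq_zero {C : ℝ}
    {V : ℝ → EuclideanSpace ℝ (Fin 3) → EuclideanSpace ℝ (Fin 3)} (hV : IsTypeIAncientMild C V)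
    {t₁ : ℝ} (ht₁ : t₁ < 0) (hcurl : ∀ x, curl (V t₁) x = 0)
    (x y : EuclideanSpace ℝ (Fin 3)) : V t₁ x = V t₁ y :=
  eq_of_curl_eq_zero_of_isDivFree_of_bounded ((hV.contDiff_slice ht₁).of_le (by norm_cast))
    hcurl (hV.isDivFree ht₁) (fun z => hV.norm_le ht₁ z) x y

/-- **A constant slice with Type-I space–time decay vanishes.** If the slice `V(t₁)`, `t₁ < 0`, is
constant and `‖V(t₁, x)‖ ≤ C₀/(‖x‖ + √(-t₁))` for all `x`, then `V(t₁) = 0`: read the bound at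
`x = R • e₀` with `R = C₀/‖V(t₁, y)‖ + 1`. [folklore] -/
theorem vortSlice_eq_zero_of_const_of_hasTypeIDecay {C₀ : ℝ}
    {V : ℝ → EuclideanSpace ℝ (Fin 3) → EuclideanSpace ℝ (Fin 3)} (hdec : HasTypeIDecay C₀ V)
    {t₁ : ℝ} (ht₁ : t₁ < 0) (hconst : ∀ x y : EuclideanSpace ℝ (Fin 3), V t₁ x = V t₁ y) :
    V t₁ = 0 := by
  funext y
  by_contra hy
  set m : ℝ := ‖V t₁ y‖ with hm
  have hm0 : 0 < m := norm_pos_iff.2 hy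
  set R : ℝ := C₀ / m + 1 with hR
  set x : EuclideanSpace ℝ (Fin 3) := R • EuclideanSpace.single 0 (1 : ℝ) with hx
  have hxn : ‖x‖ = |R| := by
    rw [hx, norm_smul, PiLp.norm_single, norm_one, mul_one, Real.norm_eq_abs]
  have hsq : 0 < Real.sqrt (-t₁) := Real.sqrt_pos.2 (neg_pos.2 ht₁)
  have hd : 0 < ‖x‖ + Real.sqrt (-t₁) := by positivity
  have key : m ≤ C₀ / (‖x‖ + Real.sqrt (-t₁)) := by
    rw [hm, ← hconst x y]
    exact hdec t₁ ht₁ x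
  have key' : m * (‖x‖ + Real.sqrt (-t₁)) ≤ C₀ := (le_div_iff₀ hd).1 key
  have e : m * R = C₀ + m := by
    rw [hR, mul_add, mul_one, mul_div_cancel₀ _ hm0.ne']
  have hRabs : R ≤ |R| := le_abs_self R
  rw [hxn] at key'
  nlinarith [mul_le_mul_of_nonneg_left hRabs hm0.le, mul_pos hm0 hsq]

/-- **An irrotational negative slice of a Type-I field with space–time decay vanishes**: constant
by Liouville for `curl W = 0`, `div W = 0` (`vortSlice_const_of_curl_eq_zero`), and the constant is
killed by the decay `C₀/(‖x‖ + √(-t₁)) → 0` (`vortSlice_eq_zero_of_const_of_hasTypeIDecay`). [cite: KochNadirashviliSereginSverak2009, Lemma 3.1] -/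
theorem vortSlice_eq_zero_of_curl_eq_zero {C C₀ : ℝ}
    {V : ℝ → EuclideanSpace ℝ (Fin 3) → EuclideanSpace ℝ (Fin 3)} (hV : IsTypeIAncientMild C V)
    (hdec : HasTypeIDecay C₀ V) {t₁ : ℝ} (ht₁ : t₁ < 0) (hcurl : ∀ x, curl (V t₁) x = 0) :
    V t₁ = 0 :=
  vortSlice_eq_zero_of_const_of_hasTypeIDecay hdec ht₁ (vortSlice_const_of_curl_eq_zero hV ht₁ hcurl)

/-! ### The registered stub -/

/-- **REGISTERED STUB `stub_vorticityEverySlice` (N9): every slice of a witness carries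
vorticity.** If `V` is an Oseen-gauge Type-I field (`IsTypeIAncientMild C V`), exactly `c`-DSS
(`c > 1`), with a Type-I space–time bound `HasTypeIDecay C₀ V`, and nonzero somewhere on the past,
then no negative slice is irrotational: `curl V(t, ·) ≢ 0` for every `t < 0`. Proof: an
irrotational slice `V(t₁)` is smooth, divergence free and bounded, hence constant
(`eq_of_curl_eq_zero_of_isDivFree_of_bounded`, KNSS 2009 Lemma 3.1), and the Type-I bound
`‖V(t₁,x)‖ ≤ C₀/(‖x‖ + √(-t₁)) → 0` makes the constant `0`; then `V ≡ 0` on the past by the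
landed helpers of N4 (`sliceNonzero_forward`: forward by uniqueness of bounded Oseen-mild
solutions; `sliceNonzero_backward`: backward along the zoom), contradicting nontriviality. [cite: KochNadirashviliSereginSverak2009, Lemma 3.1] -/
theorem stub_vorticityEverySlice :
    ∀ (c C C₀ : ℝ) (V : ℝ → EuclideanSpace ℝ (Fin 3) → EuclideanSpace ℝ (Fin 3)), 1 < c →
      IsTypeIAncientMild C V → IsDiscretelySelfSimilar c V → HasTypeIDecay C₀ V →
      (∃ t₀ < 0, ∃ x₀, V t₀ x₀ ≠ 0) → ∀ t < 0, ∃ x, curl (V t) x ≠ 0 := by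
  intro c C C₀ V hc hV hdss hdec hex t ht
  by_contra h
  push Not at h
  -- the irrotational slice vanishes
  have hV1 : V t = 0 := vortSlice_eq_zero_of_curl_eq_zero hV hdec ht h
  -- forward by Oseen-mild uniqueness, backward along the zoom
  have hVall : ∀ s < 0, V s = 0 :=
    sliceNonzero_backward hc hdss ht (sliceNonzero_forward hV hV1)
  obtain ⟨t₀, ht₀, x₀, hx₀⟩ := hex
  exact hx₀ (by rw [hVall t₀ ht₀]; rfl)

end Summit.NavierStokesRegularity.NavierStokesRegularity.Theorems.PolyhedralDssProfileExists.PolyhedralCell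

end
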